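import Literature.Computability.Complexity.SignRat
import Literature.Computability.Complexity.CodeFPStrings
import Literature.Computability.Complexity.FKPointLocationLevel
import Literature.Computability.Complexity.IrreducibilityLLLKernelFP
import HarnessLib

/-!
# Fournier–Koiran point location: the integer tests of a level are polynomial-time (typed `CodeFP`)

Topic `Literature/Computability/Complexity`, grouping namespace `FKTransfer`. The `NP` oracle of
Fournier–Koiran's location procedure (ICALP 2000 = LIP RR-1999-21, §2.1–2.2) answers questions
about INTEGER data of polynomial size: "is there a live form `a` (coefficients bounded by `B`,
orthogonal to the earlier apexes) meeting the little cube?", "is there a small rational point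
`N/d` of the affine space `E` off / on the hyperplane `a`?", … (`FKPointLocationLevel.lean`:
`LevelCtx.LiveI`, `LevelCtx.MeetsI`, `LevelCtx.SmallPt`, membership in `LevelCtx.E`). Whatever
machine asks them, their VERIFIER has to evaluate these tests in polynomial time. This file provides
the tests on LIST representations of the vectors (`idot`, `boundedL`, `orthAllL`, `l1FreeL`,
`meetsL`, `memEL`, `smallL`) together with typed polynomial-time programs for them
(`CodeFP …`, `CodeFP.lean` / `CodeFPArith.lean`; integer vectors travel in Mathlib's code
`encodingIntBool.listBool` = `listE smE`, naturals in binary `natE`, small exponents in unary `unE`),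
and the bridges to the `Fin D`-indexed definitions of `FKPointLocationLevel.lean` through
`List.ofFn` (`idot_ofFn`, `liveI_iff`, `meetsI_iff_meetsL`).

## References

* H. Fournier, P. Koiran, *Lower bounds are not easier over the reals: inside PH*, ICALP 2000,
  LNCS 1853 = LIP RR-1999-21, §2.1 (the `NP` conditions of Steps 1 and `k`), §2.2 (sizes).
  [FournierKoiran2000]
* S. Arora, B. Barak, *Computational Complexity: A Modern Approach*, CUP 2009, §1.3 (closure of
  polynomial time under composition and bounded loops). [AroraBarak2009]
-/

namespace Literature.Computability.Complexity

namespace FKTransfer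

open _root_.Computability CodeFP Finset
open LLLFactoring (idot idotC)

/-! ### The list-level tests -/

-- The integer dot product of lists is the tree's `LLLFactoring.idot` (`IrreducibilityLLLKernel.lean`,
-- `(zipWith (*) u v).sum`), with its program `LLLFactoring.idotC` (`IrreducibilityLLLKernelFP.lean`).

/-- All entries bounded by `B` in absolute value. [cite: FournierKoiran2000, §2 (coefficients in `{-2^{t(n)}, …, 2^{t(n)}}`)] -/
def boundedL (B : ℕ) (a : List ℤ) : Bool :=
  a.all fun x => decide (x.natAbs ≤ B)

/-- Orthogonality to every vector of a list (liveness w.r.t. the earlier apexes).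
[cite: FournierKoiran2000, §2.1 (`H_n^k`: through all earlier tops)] -/
def orthAllL (prev : List (List ℤ)) (a : List ℤ) : Bool :=
  prev.all fun σ => decide (idot a σ = 0)

/-- `∑_{free i} |aᵢ|` for a chart `χ` (`χᵢ = 0`: free). [cite: FournierKoiran2000, §2.1] -/
def l1FreeL (χ a : List ℤ) : ℕ :=
  (List.zipWith (fun c x => if c = 0 then x.natAbs else 0) χ a).sum

/-- The integer meeting test `|a·m| ≤ 2^e · ∑_{free} |aᵢ|` (`LevelCtx.MeetsI` with `e = κ·sc`).
[cite: FournierKoiran2000, §2.1 (`h ∩ c_n^k ≠ ∅`)] -/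
def meetsL (e : ℕ) (m χ a : List ℤ) : Bool :=
  decide ((idot a m).natAbs ≤ 2 ^ e * l1FreeL χ a)

/-- Membership of the rational point `N/d` in the affine space of a chart `χ` and a chain `ch`:
`Nᵢ = χᵢ d` on fixed coordinates and `a · N = 0` for `a ∈ ch`. [cite: FournierKoiran2000, §2.1 (the spaces `E_i`)] -/
def memEL (χ : List ℤ) (ch : List (List ℤ)) (N : List ℤ) (d : ℕ) : Bool :=
  (List.zipWith (fun c x => decide (c = 0 ∨ x = c * (d : ℤ))) χ N).all id && ch.all fun a => decide (idot a N = 0)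

/-- Smallness of a rational point `N/d`: `0 < d < 2^W`, `|N_k| < 2^W`. [cite: FournierKoiran2000, §2.2] -/
def smallL (W : ℕ) (N : List ℤ) (d : ℕ) : Bool :=
  decide (0 < d) && decide (d < 2 ^ W) && N.all fun x => decide (x.natAbs < 2 ^ W)

/-! ### Bridges to `Fin D`-indexed vectors -/

variable {D : ℕ}

/-- `zipWith` of two `ofFn` lists. [folklore] -/
theorem zipWith_ofFn {α β γ : Type} (f : α → β → γ) (a : Fin D → α) (b : Fin D → β) :
    List.zipWith f (List.ofFn a) (List.ofFn b) = List.ofFn fun i => f (a i) (b i) := by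
  apply List.ext_getElem
  · simp
  · intro i h₁ h₂
    simp

/-- The dot product of `ofFn` lists is the `Fin` sum. [folklore] -/
theorem idot_ofFn (a N : Fin D → ℤ) : idot (List.ofFn a) (List.ofFn N) = ∑ i, a i * N i := by
  rw [idot, zipWith_ofFn, List.sum_ofFn]

/-- Boundedness of an `ofFn` list. [folklore] -/
theorem boundedL_ofFn (B : ℕ) (a : Fin D → ℤ) : boundedL B (List.ofFn a) = true ↔ ∀ i, (a i).natAbs ≤ B := by
  simp [boundedL, List.all_eq_true, List.mem_ofFn]

/-- `l1FreeL` of `ofFn` lists is the `Fin` sum over free coordinates. [folklore] -/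
theorem l1FreeL_ofFn (χ a : Fin D → ℤ) :
    l1FreeL (List.ofFn χ) (List.ofFn a) = ∑ i ∈ univ.filter (fun i => χ i = 0), (a i).natAbs := by
  rw [l1FreeL, zipWith_ofFn, List.sum_ofFn, Finset.sum_filter]

/-! ### The tests are typed polynomial-time programs -/

-- Integer vectors arrive in Mathlib's code `encodingIntBool.listBool` (`listE smE`); the change to the
-- raw canonical integer code `rawE intE` used below is `SignRat.codeFP_intsOfList`.

/-- **Boundedness by a binary bound.** [cite: AroraBarak2009, §1.3] -/
theorem codeFP_boundedL : CodeFP (pairE natE (rawE intE)) bitE (fun p => boundedL p.1 p.2) := by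
  have hp : CodeFP (pairE natE intE) bitE (fun t => decide (t.2.natAbs ≤ t.1)) :=
    (natLe.comp ((intNatAbs.comp (snd natE intE)).pair (fst natE intE)) :)
  exact (all hp :)

/-- **Orthogonality to a list of vectors.** [cite: AroraBarak2009, §1.3] -/
theorem codeFP_orthAllL : CodeFP (pairE (rawE intE) (rawE (rawE intE))) bitE (fun p => orthAllL p.2 p.1) := by
  have h0 : CodeFP (pairE (rawE intE) (rawE intE)) intE (fun _ => (0 : ℤ)) := const _ _
  have hp : CodeFP (pairE (rawE intE) (rawE intE)) bitE (fun t => decide (idot t.1 t.2 = 0)) :=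
    (intEq.comp (idotC.pair h0) :)
  exact (all hp :)

/-- **The free `ℓ¹`-mass.** [cite: AroraBarak2009, §1.3] -/
theorem codeFP_l1FreeL : CodeFP (pairE (rawE intE) (rawE intE)) natE (fun p => l1FreeL p.1 p.2) := by
  have h0 : CodeFP (pairE unitE (pairE intE intE)) intE (fun _ => (0 : ℤ)) := const _ _
  have hc : CodeFP (pairE unitE (pairE intE intE)) bitE (fun t => decide (t.2.1 = 0)) :=
    (intEq.comp ((snd unitE (pairE intE intE)).fst'.pair h0) :)
  have habs : CodeFP (pairE unitE (pairE intE intE)) natE (fun t => t.2.2.natAbs) :=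
    (intNatAbs.comp (snd unitE (pairE intE intE)).snd' :)
  have hz : CodeFP (pairE unitE (pairE intE intE)) natE (fun _ => (0 : ℕ)) := const _ _
  have hg : CodeFP (pairE unitE (pairE intE intE)) natE
      (fun t => if t.2.1 = 0 then t.2.2.natAbs else 0) :=
    (ite hc habs hz).congr fun t => by by_cases h : t.2.1 = 0 <;> simp [h]
  have hzip : CodeFP (pairE unitE (pairE (rawE intE) (rawE intE))) (rawE natE)
      (fun p => List.zipWith (fun c x => if c = 0 then x.natAbs else 0) p.2.1 p.2.2) :=
    zipWith (g := fun t : Unit × ℤ × ℤ => if t.2.1 = 0 then t.2.2.natAbs else 0) hg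
  have hu : CodeFP (pairE (rawE intE) (rawE intE)) (pairE unitE (pairE (rawE intE) (rawE intE))) (fun p => ((), p)) := by
    have hc' : CodeFP (pairE (rawE intE) (rawE intE)) unitE (fun _ => ()) := const _ _
    exact hc'.pair (CodeFP.id _)
  exact (natSum.comp (hzip.comp hu) :)

/-- **The meeting test** (exponent in unary). [cite: FournierKoiran2000, §2.1] -/
theorem codeFP_meetsL :
    CodeFP (pairE unE (pairE (rawE intE) (pairE (rawE intE) (rawE intE)))) bitE
      (fun p => meetsL p.1 p.2.1 p.2.2.1 p.2.2.2) := by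
  -- p = (e, m, χ, a)
  have he : CodeFP (pairE unE (pairE (rawE intE) (pairE (rawE intE) (rawE intE)))) unE (fun p => p.1) := fst _ _
  have hm : CodeFP (pairE unE (pairE (rawE intE) (pairE (rawE intE) (rawE intE)))) (rawE intE) (fun p => p.2.1) :=
    (snd _ _).fst'
  have hχ : CodeFP (pairE unE (pairE (rawE intE) (pairE (rawE intE) (rawE intE)))) (rawE intE) (fun p => p.2.2.1) :=
    (snd _ _).snd'.fst'
  have ha : CodeFP (pairE unE (pairE (rawE intE) (pairE (rawE intE) (rawE intE)))) (rawE intE) (fun p => p.2.2.2) :=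
    (snd _ _).snd'.snd'
  have h2 : CodeFP (pairE unE (pairE (rawE intE) (pairE (rawE intE) (rawE intE)))) natE (fun _ => (2 : ℕ)) := const _ _
  have hpow : CodeFP (pairE unE (pairE (rawE intE) (pairE (rawE intE) (rawE intE)))) natE (fun p => 2 ^ p.1) :=
    (natPow.comp (h2.pair he) :)
  have hlhs : CodeFP (pairE unE (pairE (rawE intE) (pairE (rawE intE) (rawE intE)))) natE
      (fun p => (idot p.2.2.2 p.2.1).natAbs) :=
    (intNatAbs.comp (idotC.comp (ha.pair hm)) :)
  have hrhs : CodeFP (pairE unE (pairE (rawE intE) (pairE (rawE intE) (rawE intE)))) natE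
      (fun p => 2 ^ p.1 * l1FreeL p.2.2.1 p.2.2.2) :=
    (natMul.comp (hpow.pair (codeFP_l1FreeL.comp (hχ.pair ha))) :)
  exact (natLe.comp (hlhs.pair hrhs) :)

/-- **Smallness of a rational point** (width in unary). [cite: FournierKoiran2000, §2.2] -/
theorem codeFP_smallL : CodeFP (pairE unE (pairE (rawE intE) natE)) bitE (fun p => smallL p.1 p.2.1 p.2.2) := by
  -- p = (W, N, d)
  have hW : CodeFP (pairE unE (pairE (rawE intE) natE)) unE (fun p => p.1) := fst _ _
  have hN : CodeFP (pairE unE (pairE (rawE intE) natE)) (rawE intE) (fun p => p.2.1) := (snd _ _).fst'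
  have hd : CodeFP (pairE unE (pairE (rawE intE) natE)) natE (fun p => p.2.2) := (snd _ _).snd'
  have h2 : CodeFP (pairE unE (pairE (rawE intE) natE)) natE (fun _ => (2 : ℕ)) := const _ _
  have h0 : CodeFP (pairE unE (pairE (rawE intE) natE)) natE (fun _ => (0 : ℕ)) := const _ _
  have hpow : CodeFP (pairE unE (pairE (rawE intE) natE)) natE (fun p => 2 ^ p.1) := (natPow.comp (h2.pair hW) :)
  have hpos : CodeFP (pairE unE (pairE (rawE intE) natE)) bitE (fun p => decide (0 < p.2.2)) := (natLt.comp (h0.pair hd) :)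
  have hlt : CodeFP (pairE unE (pairE (rawE intE) natE)) bitE (fun p => decide (p.2.2 < 2 ^ p.1)) :=
    (natLt.comp (hd.pair hpow) :)
  have hitem : CodeFP (pairE natE intE) bitE (fun t => decide (t.2.natAbs < t.1)) :=
    (natLt.comp ((intNatAbs.comp (snd natE intE)).pair (fst natE intE)) :)
  have hall : CodeFP (pairE unE (pairE (rawE intE) natE)) bitE (fun p => p.2.1.all fun x => decide (x.natAbs < 2 ^ p.1)) :=
    ((all hitem).comp (hpow.pair hN) :)
  exact ((hpos.and hlt).and hall :)

/-- **Membership of `N/d` in the space of a chart and a chain.** [cite: FournierKoiran2000, §2.1] -/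
theorem codeFP_memEL :
    CodeFP (pairE (rawE intE) (pairE (rawE (rawE intE)) (pairE (rawE intE) natE))) bitE
      (fun p => memEL p.1 p.2.1 p.2.2.1 p.2.2.2) := by
  -- p = (χ, ch, N, d)
  have hχ : CodeFP (pairE (rawE intE) (pairE (rawE (rawE intE)) (pairE (rawE intE) natE))) (rawE intE) (fun p => p.1) :=
    fst _ _
  have hch : CodeFP (pairE (rawE intE) (pairE (rawE (rawE intE)) (pairE (rawE intE) natE))) (rawE (rawE intE))
      (fun p => p.2.1) := (snd _ _).fst'
  have hN : CodeFP (pairE (rawE intE) (pairE (rawE (rawE intE)) (pairE (rawE intE) natE))) (rawE intE)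
      (fun p => p.2.2.1) := (snd _ _).snd'.fst'
  have hd : CodeFP (pairE (rawE intE) (pairE (rawE (rawE intE)) (pairE (rawE intE) natE))) natE
      (fun p => p.2.2.2) := (snd _ _).snd'.snd'
  -- chart part: the context is `d` (as an integer), the items are pairs `(c, x)`
  have hdz : CodeFP (pairE (rawE intE) (pairE (rawE (rawE intE)) (pairE (rawE intE) natE))) intE
      (fun p => (p.2.2.2 : ℤ)) := (intOfNat.comp hd :)
  have hzero : CodeFP (pairE intE (pairE intE intE)) intE (fun _ => (0 : ℤ)) := const _ _
  have hc0 : CodeFP (pairE intE (pairE intE intE)) bitE (fun t => decide (t.2.1 = 0)) :=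
    (intEq.comp ((snd intE (pairE intE intE)).fst'.pair hzero) :)
  have hxe : CodeFP (pairE intE (pairE intE intE)) bitE (fun t => decide (t.2.2 = t.2.1 * t.1)) :=
    (intEq.comp ((snd intE (pairE intE intE)).snd'.pair
      (intMul.comp ((snd intE (pairE intE intE)).fst'.pair (fst intE (pairE intE intE))))) :)
  have hg : CodeFP (pairE intE (pairE intE intE)) bitE (fun t => decide (t.2.1 = 0 ∨ t.2.2 = t.2.1 * t.1)) :=
    (hc0.or hxe).congr fun t => by simp [Bool.decide_or]
  have hzip : CodeFP (pairE intE (pairE (rawE intE) (rawE intE))) (rawE bitE)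
      (fun q => List.zipWith (fun c x => decide (c = 0 ∨ x = c * q.1)) q.2.1 q.2.2) :=
    zipWith (g := fun t : ℤ × ℤ × ℤ => decide (t.2.1 = 0 ∨ t.2.2 = t.2.1 * t.1)) hg
  have hchart : CodeFP (pairE (rawE intE) (pairE (rawE (rawE intE)) (pairE (rawE intE) natE))) (rawE bitE)
      (fun p => List.zipWith (fun c x => decide (c = 0 ∨ x = c * (p.2.2.2 : ℤ))) p.1 p.2.2.1) :=
    (hzip.comp (hdz.pair (hχ.pair hN)) :)
  have hidb : CodeFP (pairE unitE bitE) bitE (fun t => id t.2) := ((snd unitE bitE) :)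
  have hallid : CodeFP (pairE unitE (rawE bitE)) bitE (fun q => q.2.all id) :=
    (all hidb).congr fun q => rfl
  have hu : CodeFP (pairE (rawE intE) (pairE (rawE (rawE intE)) (pairE (rawE intE) natE))) unitE (fun _ => ()) :=
    const _ _
  have hpart1 : CodeFP (pairE (rawE intE) (pairE (rawE (rawE intE)) (pairE (rawE intE) natE))) bitE
      (fun p => (List.zipWith (fun c x => decide (c = 0 ∨ x = c * (p.2.2.2 : ℤ))) p.1 p.2.2.1).all id) :=
    (hallid.comp (hu.pair hchart) :)
  -- chain part: context `N`, items `a`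
  have h0' : CodeFP (pairE (rawE intE) (rawE intE)) intE (fun _ => (0 : ℤ)) := const _ _
  have hq : CodeFP (pairE (rawE intE) (rawE intE)) bitE (fun t => decide (idot t.2 t.1 = 0)) :=
    (intEq.comp ((idotC.comp ((snd _ _).pair (fst _ _))).pair h0') :)
  have hpart2 : CodeFP (pairE (rawE intE) (pairE (rawE (rawE intE)) (pairE (rawE intE) natE))) bitE
      (fun p => p.2.1.all fun a => decide (idot a p.2.2.1 = 0)) :=
    ((all hq).comp (hN.pair hch) :)
  exact (hpart1.and hpart2).congr fun p => rfl

/-! ### Bridges to the level theory of `FKPointLocationLevel.lean` -/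

section LevelBridges

open FKPointLocation

variable {Q : LevelParams} (Λ : LevelCtx Q)

/-- **Integer liveness is the pair of list tests** (bounded by `B`, orthogonal to the earlier apex
numerators). [cite: FournierKoiran2000, §2.1] -/
theorem liveI_iff_lists (a : Fin Q.D → ℤ) :
    Λ.LiveI a ↔ boundedL Q.B (List.ofFn a) = true ∧ orthAllL (Λ.prev.map List.ofFn) (List.ofFn a) = true := by
  rw [LevelCtx.LiveI, boundedL_ofFn]
  simp only [orthAllL, List.all_eq_true, List.mem_map, decide_eq_true_eq, forall_exists_index, and_imp,
    forall_apply_eq_imp_iff₂, idot_ofFn]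

/-- **The integer meeting test is `meetsL`** with exponent `κ·sc`. [cite: FournierKoiran2000, §2.1] -/
theorem meetsI_iff_meetsL (sc : ℕ) (a : Fin Q.D → ℤ) :
    Λ.MeetsI sc a ↔ meetsL (Q.κ * sc) (List.ofFn Λ.m) (List.ofFn Λ.χ) (List.ofFn a) = true := by
  rw [LevelCtx.MeetsI, meetsL, decide_eq_true_eq, idot_ofFn, l1FreeL_ofFn]

/-- **Membership of `N/d` in `E ch` is `memEL`** (`d > 0`). [cite: FournierKoiran2000, §2.1] -/
theorem mem_E_iff_memEL (ch : List (Fin Q.D → ℤ)) (N : Fin Q.D → ℤ) {d : ℕ} (hd : 0 < d) :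
    (fun i => (N i : ℝ) / d) ∈ Λ.E ch ↔ memEL (List.ofFn Λ.χ) (ch.map List.ofFn) (List.ofFn N) d = true := by
  have hdR : (d : ℝ) ≠ 0 := by exact_mod_cast hd.ne'
  -- the chart part of the list test
  have hchart : (List.zipWith (fun c x => decide (c = 0 ∨ x = c * (d : ℤ))) (List.ofFn Λ.χ) (List.ofFn N)).all id = true ↔
      ∀ i, Λ.χ i ≠ 0 → N i = Λ.χ i * d := by
    rw [zipWith_ofFn, List.all_eq_true, List.forall_mem_ofFn_iff]
    simp only [id, decide_eq_true_eq]
    exact forall_congr' fun i => or_iff_not_imp_left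
  -- the chain part of the list test
  have hchain : ((ch.map List.ofFn).all fun a => decide (idot a (List.ofFn N) = 0)) = true ↔
      ∀ a ∈ ch, ∑ i, a i * N i = 0 := by
    rw [List.all_eq_true]
    simp only [List.mem_map, forall_exists_index, and_imp, forall_apply_eq_imp_iff₂, decide_eq_true_eq, idot_ofFn]
  -- the real side
  have hsum : ∀ a : Fin Q.D → ℤ, lin a (fun i => (N i : ℝ) / d) = ((∑ i, a i * N i : ℤ) : ℝ) / d := by
    intro a
    rw [lin]; push_cast; rw [Finset.sum_div]
    exact Finset.sum_congr rfl fun i _ => by ring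
  rw [LevelCtx.mem_E_iff, memEL, Bool.and_eq_true, hchart, hchain]
  refine and_congr (forall_congr' fun i => imp_congr_right fun _ => ?_) (forall_congr' fun a => imp_congr_right fun _ => ?_)
  · rw [div_eq_iff hdR]
    constructor
    · intro h; exact_mod_cast h
    · intro h; exact_mod_cast h
  · rw [hsum, div_eq_zero_iff, or_iff_left hdR]
    constructor
    · intro h; exact_mod_cast h
    · intro h; exact_mod_cast h

/-- **Smallness is `smallL`.** [cite: FournierKoiran2000, §2.2] -/
theorem smallL_ofFn_iff (W : ℕ) (N : Fin Q.D → ℤ) (d : ℕ) :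
    smallL W (List.ofFn N) d = true ↔ 0 < d ∧ d < 2 ^ W ∧ ∀ k, (N k).natAbs < 2 ^ W := by
  simp [smallL, List.all_eq_true, List.mem_ofFn, and_assoc]

/-- A small rational point in the sense of `LevelCtx.SmallPt` from list data passing `smallL`.
[cite: FournierKoiran2000, §2.2] -/
theorem smallPt_of_smallL {N : Fin Q.D → ℤ} {d : ℕ} (h : smallL Q.W (List.ofFn N) d = true) :
    LevelCtx.SmallPt (Q := Q) (fun k => (N k : ℝ) / d) := by
  obtain ⟨hd, hdW, hN⟩ := (smallL_ofFn_iff Q.W N d).1 h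
  exact ⟨N, d, hd, hdW, hN, rfl⟩

end LevelBridges

end FKTransfer

end Literature.Computability.Complexity
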